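import Mathlib
import HarnessLib
import Summits.PneNP.PneNP.Theorems.AeaCutRectanglesSparseCoreLemma

/-!
# Crux `FoolingMeasure` (stmt-PneNP-19727): HALF-SPARSE CORES up to average degree SIX (graph-theoretic lemma)

Lead prover pnp-aea-p1 g2 (2026-08-27), route `AeaCutRectangles`.  Sharpening of
`AeaCutRectanglesSparseCoreLemma.halfSparse_of_sparse_core` (threshold `|F| ≤ (8n-20)/3`, average degree `16/3`)
to `|F| ≤ 3n - 11` (average degree `6`), pure finite graph theory: for a loopless edge set `F` over `Fin n` with
an edge `e` such that `F ∖ e` is 3-colourable (every 4-critical graph qualifies), 3-colour `F ∖ e` with classes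
`X_0, X_1, X_2`; if no class reaches `⌈n/2⌉` vertices, take for each ORDERED pair `(a,b)` the half `X_a ∪ T` where
`T ⊆ X_b` consists of `⌈n/2⌉ - |X_a|` vertices of `X_b` with fewest neighbours in `X_a`
(`exists_subset_small_weight`: the `t` lightest of `s` weights carry at most the fraction `t/s` of the total).
Its inside edges are `e` (possibly) plus the chosen `X_a`–`X_b` edges.  If all six halves carried `> n/2` edges,
adding the two orientations of each pair gives `|E_ab|·(|X_c| + 1) ≥ ⌊n/2⌋·(n - |X_c|)`; with
`Σ|E_ab| ≤ |F| - 1` and the AM–HM inequality for the three numbers `|X_c| + 1` (sum `n + 3`) this forces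
`(|F| - 1)(n + 3) ≥ 3n(n - 1)`, i.e. `|F| ≥ 3n - 10`.

* `exists_subset_small_weight` — the lightest-part averaging lemma;
* **`halfSparse_of_core_lt_three`** — `|F| + 11 ≤ 3n` ⇒ some `S` with `2|S| ≥ n` and `2|F[S]| ≤ n`.
Used by `AeaCutRectanglesSparseCoresSix` (X1 restricted to supports with a 4-critical core of `≤ 3n - 11` edges is
false).  HALF-SPARSE CORE (`FoolingMeasure.Negative.HalfSparseCore`) thus remains open exactly for 4-critical
graphs with at least `3n - 10` edges (average degree `≥ 6 - 20/n`).

HONEST FRAMING: elementary extremal counting; FRONTIER material for a rung of Fagin's complement ladder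
(NON-3-COL vs ESO(∀∃∀)); restricted-model witness — nothing here bears on P vs NP.
-/

set_option linter.dupNamespace false
set_option autoImplicit false

namespace Summit.PneNP.PneNP.Theorems.AeaCutRectanglesSparseCoreLemmaSix

open Finset
open Summit.PneNP.PneNP.Theorems.AeaCutRectanglesDutyRectangles
open Summit.PneNP.PneNP.Theorems.AeaCutRectanglesSparseCoreLemma

/-! ### The lightest `t` weights -/

section Weights

variable {V : Type*} [DecidableEq V]

/-- **Lightest part.**  Among `s` weighted points there are `t ≤ s` of total weight at most the fraction `t/s` of
the whole: `(Σ_T w)·s ≤ (Σ_U w)·t`  (remove a heaviest point `s - t` times). -/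
theorem exists_subset_small_weight (t : ℕ) :
    ∀ (s : ℕ) (U : Finset V) (w : V → ℕ), U.card = s → t ≤ s →
      ∃ T, T ⊆ U ∧ T.card = t ∧ (∑ v ∈ T, w v) * s ≤ (∑ v ∈ U, w v) * t := by
  intro s
  induction s using Nat.strong_induction_on with
  | _ s ih =>
    intro U w hUs hts
    by_cases hst : s = t
    · subst hst
      exact ⟨U, Subset.refl _, hUs, le_rfl⟩
    · have hs1 : t + 1 ≤ s := by omega
      have hUne : U.Nonempty := by rw [← card_pos, hUs]; omega
      obtain ⟨v, hvU, hvmax⟩ := exists_max_image U w hUne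
      have hW : ∑ u ∈ U, w u ≤ s * w v := by
        have := sum_le_card_nsmul U w (w v) fun u hu => hvmax u hu
        rwa [hUs, smul_eq_mul] at this
      set U' : Finset V := U.erase v with hU'
      have hU's : U'.card = s - 1 := by rw [hU', card_erase_of_mem hvU, hUs]
      obtain ⟨T, hTU', hTt, hle⟩ := ih (s - 1) (by omega) U' w hU's (by omega)
      have hsum' : ∑ u ∈ U', w u + w v = ∑ u ∈ U, w u := sum_erase_add _ _ hvU
      refine ⟨T, hTU'.trans (erase_subset _ _), hTt, ?_⟩
      set A := ∑ u ∈ T, w u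
      set W' := ∑ u ∈ U', w u
      set W := ∑ u ∈ U, w u
      -- hle : A (s-1) ≤ W' t ;  s W' ≤ (s-1) W ;  conclude A s ≤ W t
      rcases Nat.lt_or_ge 1 s with hs2 | hs2
      · have h1 : s * W' ≤ (s - 1) * W := by
          have e1 : (s - 1) * W = s * W - W := by rw [Nat.sub_mul, one_mul]
          rw [e1, ← hsum']
          have : W ≤ s * w v := hW
          rw [← hsum'] at this
          have e2 : s * (W' + w v) = s * W' + s * w v := by ring
          rw [e2]
          omega
        have h2 : A * (s - 1) * s ≤ W * t * (s - 1) := by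
          calc A * (s - 1) * s ≤ W' * t * s := Nat.mul_le_mul_right _ hle
            _ = s * W' * t := by ring
            _ ≤ (s - 1) * W * t := Nat.mul_le_mul_right _ h1
            _ = W * t * (s - 1) := by ring
        have hpos : 0 < s - 1 := by omega
        have h3 : A * s * (s - 1) ≤ W * t * (s - 1) := by
          calc A * s * (s - 1) = A * (s - 1) * s := by ring
            _ ≤ W * t * (s - 1) := h2
        exact Nat.le_of_mul_le_mul_right h3 hpos
      · -- s ≤ 1 and t < s force t = 0
        have ht0 : t = 0 := by omega
        subst ht0
        rw [card_eq_zero] at hTt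
        subst hTt
        have hA : A = 0 := sum_empty
        rw [hA]; simp

end Weights

/-! ### Half-sparse cores up to `3n - 11` edges -/

/-- **Half-sparse cores, up to average degree six.**  Let `F` be a loopless edge set over `Fin n` (`n ≥ 2`) with
an edge `e` such that `F ∖ e` is 3-colourable (e.g. `F` 4-critical), and `|F| + 11 ≤ 3n`.  Then some vertex set `S`
with `2|S| ≥ n` spans at most `n/2` edges of `F`.  (Non-3-colourability of `F` is not even needed.) -/
theorem halfSparse_of_core_lt_three {n : ℕ} (hn : 2 ≤ n) (F : Finset (Sym2 (Fin n)))
    (hl : ∀ e ∈ F, ¬ e.IsDiag)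
    {e : Sym2 (Fin n)} (he : e ∈ F)
    (hFe : (SimpleGraph.fromEdgeSet ((F.erase e : Finset (Sym2 (Fin n))) : Set (Sym2 (Fin n)))).Colorable 3)
    (hm : F.card + 11 ≤ 3 * n) :
    ∃ S : Finset (Fin n), n ≤ 2 * S.card ∧ 2 * (bobSide S F).card ≤ n := by
  classical
  obtain ⟨c, hc⟩ := (colorable_iff_exists_not_mem_killSet _).1 hFe
  set h : ℕ := (n + 1) / 2 with hh
  set X : Fin 3 → Finset (Fin n) := fun k => univ.filter (fun v => c v = k) with hX
  -- an edge of F other than e is properly coloured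
  have proper : ∀ e' ∈ F, e' ≠ e → ¬ (e'.map c).IsDiag :=
    fun e' he' hne => ne_of_not_mem_killSet_erase hc he' hne (hl e' he')
  by_cases hbig : ∃ k, h ≤ (X k).card
  · -- Case A: a big colour class spans only `e`
    obtain ⟨k, hk⟩ := hbig
    refine ⟨X k, by omega, ?_⟩
    have : (bobSide (X k) F).card ≤ 1 := by
      rw [Finset.card_le_one]
      intro a ha b hb
      have key : ∀ e' ∈ bobSide (X k) F, e' = e := by
        intro e' he'
        obtain ⟨he'F, hin⟩ := mem_bobSide.1 he'
        by_contra hne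
        apply proper e' he'F hne
        induction e' using Sym2.ind with
        | h x y =>
          exact (map_mk_isDiag_iff c x y).2
            (((mem_filter.1 (hin x (Sym2.mem_mk_left _ _))).2).trans
              ((mem_filter.1 (hin y (Sym2.mem_mk_right _ _))).2).symm)
      rw [key a ha, key b hb]
    omega
  · push Not at hbig
    have hUX : ∀ k, (X k).card + (univ.filter (fun v => c v ≠ k)).card = n := by
      intro k
      have := card_filter_add_card_filter_not (s := (univ : Finset (Fin n))) (fun v => c v = k)
      simpa only [card_univ, Fintype.card_fin] using this
    have hXsum : ∑ k, (X k).card = n := by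
      have := (Finset.card_eq_sum_card_fiberwise (s := (univ : Finset (Fin n))) (t := (univ : Finset (Fin 3)))
        (f := c) (fun _ _ => mem_univ _)).symm
      simpa [hX] using this
    -- cross edge sets E a b := edges of F ∖ e inside X a ∪ X b
    set E : Fin 3 → Fin 3 → Finset (Sym2 (Fin n)) := fun a b => bobSide (X a ∪ X b) (F.erase e) with hE
    -- weights: edges at v ∈ X b towards X a
    set w : Fin 3 → Fin n → ℕ := fun a v =>
      ((F.erase e).filter (fun f => v ∈ f ∧ ∀ u ∈ f, u ≠ v → c u = a)).card with hw
    -- (i) the weights over X b sum to at most |E a b|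
    have hwsum : ∀ a b, a ≠ b → ∑ v ∈ X b, w a v ≤ (E a b).card := by
      intro a b hab
      have hdisj : ((X b : Finset (Fin n)) : Set (Fin n)).PairwiseDisjoint
          (fun v => (F.erase e).filter (fun f => v ∈ f ∧ ∀ u ∈ f, u ≠ v → c u = a)) := by
        intro v hv v' hv' hvv'
        rw [Function.onFun, disjoint_left]
        intro f hf hf'
        obtain ⟨hfF, hvf, hfa⟩ := mem_filter.1 hf
        obtain ⟨-, hv'f, -⟩ := mem_filter.1 hf'
        have hcv' : c v' = a := hfa v' hv'f (Ne.symm hvv')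
        have hbv' : c v' = b := (mem_filter.1 hv').2
        exact hab (hcv'.symm.trans hbv')
      rw [← card_biUnion hdisj]
      refine card_le_card fun f hf => ?_
      obtain ⟨v, hv, hfv⟩ := mem_biUnion.1 hf
      obtain ⟨hfF, hvf, hfa⟩ := mem_filter.1 hfv
      refine mem_bobSide.2 ⟨hfF, fun u hu => ?_⟩
      by_cases huv : u = v
      · subst huv; exact mem_union.2 (Or.inr hv)
      · exact mem_union.2 (Or.inl (mem_filter.2 ⟨mem_univ _, hfa u hu huv⟩))
    -- (ii) the three cross edge sets (unordered) are disjoint parts of F ∖ e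
    have hEsymm : ∀ a b, E a b = E b a := by intro a b; simp only [hE, union_comm]
    have hEle : (E 0 1).card + (E 0 2).card + (E 1 2).card ≤ F.card - 1 := by
      have hcols : ∀ a b (x y : Fin n), s(x, y) ∈ E a b → ({c x, c y} : Finset (Fin 3)) = {a, b} := by
        intro a b x y hf
        obtain ⟨hfF, hin⟩ := mem_bobSide.1 hf
        obtain ⟨hfe, hfF'⟩ := mem_erase.1 hfF
        have hx := hin x (Sym2.mem_mk_left _ _); have hy := hin y (Sym2.mem_mk_right _ _)
        have hxy : c x ≠ c y := fun h' => proper _ hfF' hfe ((map_mk_isDiag_iff c x y).2 h')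
        have hx' : c x = a ∨ c x = b := by
          rcases mem_union.1 hx with h' | h'
          · exact Or.inl (mem_filter.1 h').2
          · exact Or.inr (mem_filter.1 h').2
        have hy' : c y = a ∨ c y = b := by
          rcases mem_union.1 hy with h' | h'
          · exact Or.inl (mem_filter.1 h').2
          · exact Or.inr (mem_filter.1 h').2
        rcases hx' with hxa | hxb <;> rcases hy' with hya | hyb
        · exact absurd (hxa.trans hya.symm) hxy
        · rw [hxa, hyb]
        · rw [hxb, hya, pair_comm]
        · exact absurd (hxb.trans hyb.symm) hxy
      have hdis : ∀ a b a' b', ({a, b} : Finset (Fin 3)) ≠ {a', b'} → Disjoint (E a b) (E a' b') := by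
        intro a b a' b' hne
        rw [disjoint_left]
        intro f hf hf'
        induction f using Sym2.ind with
        | h x y => exact hne ((hcols a b x y hf).symm.trans (hcols a' b' x y hf'))
      have hsub : E 0 1 ∪ E 0 2 ∪ E 1 2 ⊆ F.erase e := by
        intro f hf
        rcases mem_union.1 hf with hf | hf
        · rcases mem_union.1 hf with hf | hf <;> exact (mem_bobSide.1 hf).1
        · exact (mem_bobSide.1 hf).1
      have d01_02 : Disjoint (E 0 1) (E 0 2) := hdis 0 1 0 2 (by decide)
      have d01_12 : Disjoint (E 0 1) (E 1 2) := hdis 0 1 1 2 (by decide)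
      have d02_12 : Disjoint (E 0 2) (E 1 2) := hdis 0 2 1 2 (by decide)
      have := card_le_card hsub
      rw [card_union_of_disjoint (disjoint_union_left.2 ⟨d01_12, d02_12⟩),
        card_union_of_disjoint d01_02, card_erase_of_mem he] at this
      exact this
    -- (iii) for each ordered pair a ≠ b a half X a ∪ T with few edges, or else |E a b|·(h - x_a) ≥ ⌊n/2⌋·x_b
    have hpair : ∀ a b, a ≠ b → h - (X a).card ≤ (X b).card →
        (∃ S : Finset (Fin n), n ≤ 2 * S.card ∧ 2 * (bobSide S F).card ≤ n) ∨
        (n / 2) * (X b).card ≤ (E a b).card * (h - (X a).card) := by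
      intro a b hab hXb
      set t : ℕ := h - (X a).card with ht
      obtain ⟨T, hTX, hTt, hTw⟩ := exists_subset_small_weight t _ (X b) (w a) rfl hXb
      set S : Finset (Fin n) := X a ∪ T with hS
      have hdisjS : Disjoint (X a) T := by
        rw [disjoint_left]; intro v hva hvT
        have h1 := (mem_filter.1 hva).2; have h2 := (mem_filter.1 (hTX hvT)).2
        exact hab (h1.symm.trans h2)
      have hScard : S.card = h := by
        rw [hS, card_union_of_disjoint hdisjS, hTt, ht]
        have := hbig a; omega
      -- edges of F inside S: e, or an X a–T edge counted by the weights of T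
      have hinside : (bobSide S F).card ≤ (∑ v ∈ T, w a v) + 1 := by
        have hsub : bobSide S F ⊆
            insert e (T.biUnion (fun v => (F.erase e).filter (fun f => v ∈ f ∧ ∀ u ∈ f, u ≠ v → c u = a))) := by
          intro f hf
          obtain ⟨hfF, hin⟩ := mem_bobSide.1 hf
          by_cases hfe : f = e
          · exact mem_insert.2 (Or.inl hfe)
          refine mem_insert.2 (Or.inr ?_)
          rw [mem_biUnion]
          induction f using Sym2.ind with
          | h x y =>
            have hx := hin x (Sym2.mem_mk_left _ _); have hy := hin y (Sym2.mem_mk_right _ _)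
            have hxy : c x ≠ c y := fun h' => proper _ hfF hfe ((map_mk_isDiag_iff c x y).2 h')
            rcases mem_union.1 hx with hxa | hxT <;> rcases mem_union.1 hy with hya | hyT
            · exact absurd (((mem_filter.1 hxa).2).trans ((mem_filter.1 hya).2).symm) hxy
            · refine ⟨y, hyT, mem_filter.2 ⟨mem_erase.2 ⟨hfe, hfF⟩, Sym2.mem_mk_right _ _, ?_⟩⟩
              intro u hu huy
              rcases Sym2.mem_iff.1 hu with rfl | rfl
              · exact (mem_filter.1 hxa).2
              · exact absurd rfl huy
            · refine ⟨x, hxT, mem_filter.2 ⟨mem_erase.2 ⟨hfe, hfF⟩, Sym2.mem_mk_left _ _, ?_⟩⟩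
              intro u hu hux
              rcases Sym2.mem_iff.1 hu with rfl | rfl
              · exact absurd rfl hux
              · exact (mem_filter.1 hya).2
            · exact absurd (((mem_filter.1 (hTX hxT)).2).trans ((mem_filter.1 (hTX hyT)).2).symm) hxy
        calc (bobSide S F).card ≤ _ := card_le_card hsub
          _ ≤ (T.biUnion _).card + 1 := card_insert_le _ _
          _ ≤ (∑ v ∈ T, w a v) + 1 := Nat.add_le_add_right card_biUnion_le _
      by_cases hgood : 2 * (bobSide S F).card ≤ n
      · exact Or.inl ⟨S, by rw [hScard]; omega, hgood⟩
      · right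
        -- Σ_T w ≥ n/2, and (Σ_T w)·|X b| ≤ (Σ_{X b} w)·t ≤ |E a b|·t
        have h1 : n / 2 ≤ ∑ v ∈ T, w a v := by omega
        have h2 := hwsum a b hab
        calc n / 2 * (X b).card ≤ (∑ v ∈ T, w a v) * (X b).card := Nat.mul_le_mul_right _ h1
          _ ≤ (∑ v ∈ X b, w a v) * t := hTw
          _ ≤ (E a b).card * t := Nat.mul_le_mul_right _ h2
    -- (iv) if no pair gives a good half, derive the contradiction
    by_contra hnone
    have hx3 : (X 0).card + (X 1).card + (X 2).card = n := by
      have := hXsum; simpa [Fin.sum_univ_succ, add_assoc] using this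
    have hx0 := hbig 0; have hx1 := hbig 1; have hx2 := hbig 2
    have hbad : ∀ a b, a ≠ b → h - (X a).card ≤ (X b).card →
        (n / 2) * (X b).card ≤ (E a b).card * (h - (X a).card) := by
      intro a b hab hXb
      rcases hpair a b hab hXb with hgood | hbad
      · exact absurd hgood hnone
      · exact hbad
    have b01 := hbad 0 1 (by decide) (by omega); have b10 := hbad 1 0 (by decide) (by omega)
    have b02 := hbad 0 2 (by decide) (by omega); have b20 := hbad 2 0 (by decide) (by omega)
    have b12 := hbad 1 2 (by decide) (by omega); have b21 := hbad 2 1 (by decide) (by omega)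
    rw [hEsymm 1 0] at b10; rw [hEsymm 2 0] at b20; rw [hEsymm 2 1] at b21
    set x0 := (X 0).card; set x1 := (X 1).card; set x2 := (X 2).card
    set P2 := (E 0 1).card; set P1 := (E 0 2).card; set P0 := (E 1 2).card
    set T0 := n / 2 with hT0
    have hT0' : n ≤ 2 * T0 + 1 := by omega
    have hh2 : 2 * h ≤ n + 1 := by omega
    have hF1 : 1 ≤ F.card := card_pos.2 ⟨e, he⟩
    -- to ℤ
    have hx0' : x0 ≤ h := le_of_lt hx0
    have hx1' : x1 ≤ h := le_of_lt hx1
    have hx2' : x2 ≤ h := le_of_lt hx2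
    zify [hx0', hx1', hx2', hF1] at b01 b10 b02 b20 b12 b21 hEle hx3 hm hT0' hh2 hn
    -- pair sums: P_c (x_c + 1) ≥ T0 (n - x_c)
    have hP2h := mul_le_mul_of_nonneg_left hh2 (by positivity : (0 : ℤ) ≤ (P2 : ℤ))
    have hP1h := mul_le_mul_of_nonneg_left hh2 (by positivity : (0 : ℤ) ≤ (P1 : ℤ))
    have hP0h := mul_le_mul_of_nonneg_left hh2 (by positivity : (0 : ℤ) ≤ (P0 : ℤ))
    have q2 : (T0 : ℤ) * ((n : ℤ) - x2) ≤ (P2 : ℤ) * ((x2 : ℤ) + 1) := by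
      have e1 : (T0 : ℤ) * ((n : ℤ) - x2) = (T0 : ℤ) * x1 + (T0 : ℤ) * x0 := by rw [← hx3]; ring
      have e2 : (P2 : ℤ) * ((x2 : ℤ) + 1) = (P2 : ℤ) * ((n : ℤ) + 1) - (P2 : ℤ) * x0 - (P2 : ℤ) * x1 := by
        rw [← hx3]; ring
      rw [e1, e2]
      have e3 : (P2 : ℤ) * ((h : ℤ) - x0) + (P2 : ℤ) * ((h : ℤ) - x1) =
          (P2 : ℤ) * (2 * (h : ℤ)) - (P2 : ℤ) * x0 - (P2 : ℤ) * x1 := by ring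
      linarith
    have q1 : (T0 : ℤ) * ((n : ℤ) - x1) ≤ (P1 : ℤ) * ((x1 : ℤ) + 1) := by
      have e1 : (T0 : ℤ) * ((n : ℤ) - x1) = (T0 : ℤ) * x2 + (T0 : ℤ) * x0 := by rw [← hx3]; ring
      have e2 : (P1 : ℤ) * ((x1 : ℤ) + 1) = (P1 : ℤ) * ((n : ℤ) + 1) - (P1 : ℤ) * x0 - (P1 : ℤ) * x2 := by
        rw [← hx3]; ring
      rw [e1, e2]
      have e3 : (P1 : ℤ) * ((h : ℤ) - x0) + (P1 : ℤ) * ((h : ℤ) - x2) =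
          (P1 : ℤ) * (2 * (h : ℤ)) - (P1 : ℤ) * x0 - (P1 : ℤ) * x2 := by ring
      linarith
    have q0 : (T0 : ℤ) * ((n : ℤ) - x0) ≤ (P0 : ℤ) * ((x0 : ℤ) + 1) := by
      have e1 : (T0 : ℤ) * ((n : ℤ) - x0) = (T0 : ℤ) * x2 + (T0 : ℤ) * x1 := by rw [← hx3]; ring
      have e2 : (P0 : ℤ) * ((x0 : ℤ) + 1) = (P0 : ℤ) * ((n : ℤ) + 1) - (P0 : ℤ) * x1 - (P0 : ℤ) * x2 := by
        rw [← hx3]; ring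
      rw [e1, e2]
      have e3 : (P0 : ℤ) * ((h : ℤ) - x1) + (P0 : ℤ) * ((h : ℤ) - x2) =
          (P0 : ℤ) * (2 * (h : ℤ)) - (P0 : ℤ) * x1 - (P0 : ℤ) * x2 := by ring
      linarith
    have hy0p : (0 : ℤ) < (x0 : ℤ) + 1 := by omega
    have hy1p : (0 : ℤ) < (x1 : ℤ) + 1 := by omega
    have hy2p : (0 : ℤ) < (x2 : ℤ) + 1 := by omega
    have hT0nn : (0 : ℤ) ≤ T0 := by omega
    -- multiply each pair inequality by the product of the other two (x + 1)'s and add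
    have r0 := mul_le_mul_of_nonneg_right q0 (mul_nonneg hy1p.le hy2p.le)
    have r1 := mul_le_mul_of_nonneg_right q1 (mul_nonneg hy0p.le hy2p.le)
    have r2 := mul_le_mul_of_nonneg_right q2 (mul_nonneg hy0p.le hy1p.le)
    have s1 : (T0 : ℤ) * (((n : ℤ) + 1) * (((x0 : ℤ) + 1) * ((x1 : ℤ) + 1) + ((x1 : ℤ) + 1) * ((x2 : ℤ) + 1) +
          ((x0 : ℤ) + 1) * ((x2 : ℤ) + 1)) - 3 * (((x0 : ℤ) + 1) * ((x1 : ℤ) + 1) * ((x2 : ℤ) + 1))) ≤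
        ((P0 : ℤ) + P1 + P2) * (((x0 : ℤ) + 1) * ((x1 : ℤ) + 1) * ((x2 : ℤ) + 1)) := by
      have hsum3 := add_le_add (add_le_add r0 r1) r2
      have e1 : (T0 : ℤ) * (((n : ℤ) + 1) * (((x0 : ℤ) + 1) * ((x1 : ℤ) + 1) + ((x1 : ℤ) + 1) * ((x2 : ℤ) + 1) +
          ((x0 : ℤ) + 1) * ((x2 : ℤ) + 1)) - 3 * (((x0 : ℤ) + 1) * ((x1 : ℤ) + 1) * ((x2 : ℤ) + 1))) =
          (T0 : ℤ) * ((n : ℤ) - x0) * (((x1 : ℤ) + 1) * ((x2 : ℤ) + 1)) +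
          (T0 : ℤ) * ((n : ℤ) - x1) * (((x0 : ℤ) + 1) * ((x2 : ℤ) + 1)) +
          (T0 : ℤ) * ((n : ℤ) - x2) * (((x0 : ℤ) + 1) * ((x1 : ℤ) + 1)) := by ring
      have e2 : ((P0 : ℤ) + P1 + P2) * (((x0 : ℤ) + 1) * ((x1 : ℤ) + 1) * ((x2 : ℤ) + 1)) =
          (P0 : ℤ) * ((x0 : ℤ) + 1) * (((x1 : ℤ) + 1) * ((x2 : ℤ) + 1)) +
          (P1 : ℤ) * ((x1 : ℤ) + 1) * (((x0 : ℤ) + 1) * ((x2 : ℤ) + 1)) +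
          (P2 : ℤ) * ((x2 : ℤ) + 1) * (((x0 : ℤ) + 1) * ((x1 : ℤ) + 1)) := by ring
      rw [e1, e2]; exact hsum3
    -- AM–HM: (y0+y1+y2)(Σ y_i y_j) ≥ 9 y0 y1 y2 with y_i = x_i + 1, y0+y1+y2 = n + 3
    have s2 : 9 * (((x0 : ℤ) + 1) * ((x1 : ℤ) + 1) * ((x2 : ℤ) + 1)) ≤
        ((n : ℤ) + 3) * (((x0 : ℤ) + 1) * ((x1 : ℤ) + 1) + ((x1 : ℤ) + 1) * ((x2 : ℤ) + 1) +
          ((x0 : ℤ) + 1) * ((x2 : ℤ) + 1)) := by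
      have e3 : ((n : ℤ) + 3) = ((x0 : ℤ) + 1) + ((x1 : ℤ) + 1) + ((x2 : ℤ) + 1) := by linarith
      rw [e3]
      have p1 : 0 ≤ ((x2 : ℤ) + 1) * ((x0 : ℤ) - x1) ^ 2 := mul_nonneg hy2p.le (sq_nonneg _)
      have p2 : 0 ≤ ((x0 : ℤ) + 1) * ((x1 : ℤ) - x2) ^ 2 := mul_nonneg hy0p.le (sq_nonneg _)
      have p3 : 0 ≤ ((x1 : ℤ) + 1) * ((x0 : ℤ) - x2) ^ 2 := mul_nonneg hy1p.le (sq_nonneg _)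
      have key : (((x0 : ℤ) + 1) + ((x1 : ℤ) + 1) + ((x2 : ℤ) + 1)) *
            (((x0 : ℤ) + 1) * ((x1 : ℤ) + 1) + ((x1 : ℤ) + 1) * ((x2 : ℤ) + 1) + ((x0 : ℤ) + 1) * ((x2 : ℤ) + 1)) -
            9 * (((x0 : ℤ) + 1) * ((x1 : ℤ) + 1) * ((x2 : ℤ) + 1)) =
          ((x2 : ℤ) + 1) * ((x0 : ℤ) - x1) ^ 2 + ((x0 : ℤ) + 1) * ((x1 : ℤ) - x2) ^ 2 +
            ((x1 : ℤ) + 1) * ((x0 : ℤ) - x2) ^ 2 := by ring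
      linarith only [p1, p2, p3, key]
    have hπ : (0 : ℤ) < ((x0 : ℤ) + 1) * ((x1 : ℤ) + 1) * ((x2 : ℤ) + 1) := mul_pos (mul_pos hy0p hy1p) hy2p
    have hPsum : (P0 : ℤ) + P1 + P2 ≤ (F.card : ℤ) - 1 := by linarith only [hEle]
    -- chain: 6n·T0·π ≤ (Σ P)(n+3)π ≤ (|F|-1)(n+3)π
    have a1 := mul_le_mul_of_nonneg_left s2 (mul_nonneg hT0nn (by omega : (0 : ℤ) ≤ (n : ℤ) + 1))
    have a2 := mul_le_mul_of_nonneg_left s1 (by omega : (0 : ℤ) ≤ (n : ℤ) + 3)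
    have a3 := mul_le_mul_of_nonneg_right hPsum hπ.le
    have a3' := mul_le_mul_of_nonneg_left a3 (by omega : (0 : ℤ) ≤ (n : ℤ) + 3)
    have s3 : (T0 : ℤ) * (6 * (n : ℤ)) * (((x0 : ℤ) + 1) * ((x1 : ℤ) + 1) * ((x2 : ℤ) + 1)) ≤
        ((F.card : ℤ) - 1) * ((n : ℤ) + 3) * (((x0 : ℤ) + 1) * ((x1 : ℤ) + 1) * ((x2 : ℤ) + 1)) := by
      ring_nf at a1 a2 a3' ⊢
      linarith only [a1, a2, a3']
    have s4 : (T0 : ℤ) * (6 * (n : ℤ)) ≤ ((F.card : ℤ) - 1) * ((n : ℤ) + 3) := le_of_mul_le_mul_right s3 hπ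
    have t1 := mul_le_mul_of_nonneg_left hT0' (by omega : (0 : ℤ) ≤ 3 * (n : ℤ))
    have t2 := mul_le_mul_of_nonneg_right hm (by omega : (0 : ℤ) ≤ (n : ℤ) + 3)
    ring_nf at t1 t2 s4
    linarith only [t1, t2, s4, hn]

end Summit.PneNP.PneNP.Theorems.AeaCutRectanglesSparseCoreLemmaSix
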